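import Summits.Langlands.Langlands.Theses.RationalPeriodQuarter
import Summits.Langlands.Langlands.Theorems.RationalPeriodQuarterHeckePreservesRationalPeriodsDefs

/-!
# `RationalPeriodClassesQuarter` (stmt-Langlands-2804) — graded split `SelfTwistPeriodLadder`

Kernel-checked decomposition glue (decomp-langlands lens-1 «grading / quantitative ladder», g41) for the BLOCKER
of the live route `RationalPeriodQuarter`: its rank-2 crux `RationalPeriodClassesQuarter` ("THE BET": the
`λ = 1/4` Maass cusp forms `S(N)` on `Γ₁(N)` are spanned by forms whose Lewis–Zagier period class is represented,
modulo semi-analytic coboundaries, by a `PR_ℚ`-valued cocycle), binder `h₁` of the route's certified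
`closes h₁ … h₇ : _root_.Langlands := h₇ (h₆ (h₅ h₁ h₂ h₃ h₄))` — after `h₂ h₃ h₄` (2805, 2806, 2807) were PROVED
(2026-08-31/09-01) the only open non-residual binder.

GRADING.  Grade a Hecke eigenform `v ∈ S(N)` by its FUNCTORIAL TYPE: grade 0 = SELF-TWIST (`v ⊗ χ = v` for a
quadratic Dirichlet character `χ ≠ 1`, i.e. `T'_p v = 0` whenever `χ(p) = -1`; by automorphic induction these are
exactly Maass' 1949 theta forms of finite-order Hecke characters of real quadratic fields — the DIHEDRAL sink of the
sector), grade 1 = everything else (tetrahedral / octahedral / icosahedral Artin type or non-Artin: the HEART).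
The node is the AND-split along this grading, plus its decisive bottom rung:

    RationalPeriodClassesQuarter ⟸ (P1) `EigenformSpan` ∧ (P2) `SelfTwistRational` ∧ (P3) `NonSelfTwistRational`
    (glue `rationalPeriodClassesQuarter_of_pieces`, 0 sorry; the target BY NAME),

    necessity  `selfTwistRational_of_target`, `nonSelfTwistRational_of_target` (P2, P3 are literal restrictions),
    rung       `rationalClassExists_of_selfTwistRational : P2 → SelfTwistQuarterFormExists → RationalClassExists`,
    kill       `not_target_of_noRationalClass : SelfTwistQuarterFormExists → ¬ RationalClassExists → ¬ target`.

(P1) EIGENFORM SPAN (support · KNOWN): `S(N)` is finite-dimensional (discreteness of the cuspidal spectrum) and the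
     normal commuting operators `T'_p` (`p ∤ N`; adjoint `⟨p⟩⁻¹ T'_p`) are simultaneously diagonalisable, so every
     `u ∈ S(N)` is a finite `ℂ`-combination of simultaneous Hecke eigenforms.  [Iwaniec, *Spectral methods* (2002)
     Thms 4.7, 6.7, §8.5–8.6; Diamond–Shurman Thm 5.5.4; Bump (1997) Ex. 1.9.4 p. 114.]
(P2) SELF-TWIST RUNG (crux · UNDECIDED, test = the rung `RationalClassExists` on ONE theta form): every self-twist
     quarter eigenform lies in the `ℂ`-span of the forms with a rational period class.  The forms are EXPLICIT
     (`a(𝔞) = ψ(𝔞)`, `K₀`-Bessel expansions, Hecke field `ℚ(ψ) ∩ ℝ`), their motive (an Artin motive) EXISTS, and the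
     Bruggeman–Lewis–Zagier local–global criterion (memo §3) makes the rung a `u`-free search over `PR_ℚ` cochains on
     generators of `Γ₁(N)`: if Eichler–Shimura rationality at eigenvalue `1/4` holds anywhere, it holds here.
(P3) NON-SELF-TWIST HEART (crux · residual · IDEA-NEEDED): the same for eigenforms that are not self-twist.  Strictly
     weaker than the target because (P2) is open; NOT an `X → target` junction (a restriction to a sub-population).
RUNG `RationalClassExists` (aside · UNDECIDED · INSTRUMENTABLE): SOME nonzero quarter cusp form at SOME level has a
     rational period class — the `∃`-shadow of (P2) (given the known `SelfTwistQuarterFormExists`, Maass 1949 =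
     Bump Thm 1.9.1), never decided in print; its negation is the strong form of the route's kill item
     `NoRationalPeriodClass` (stmt-Langlands-2808) and refutes the target outright (`not_target_of_noRationalClass`).
RUNG E′ `RationalCuspidalCocycleExists` (aside · `u`-FREE · INSTRUMENTABLE) and the named fact
     `BLZTheoremBSurjectiveQuarter` (KNOWN IN PRINT: Bruggeman–Lewis–Zagier Thm B at `s = 1/2`, not yet vendored):
     `rationalClassExists_of_cuspidalCocycle : BLZTheoremBSurjectiveQuarter → RationalCuspidalCocycleExists →
     RationalClassExists` (proved below) — the rung restated WITHOUT any Maass form, as the existence of a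
     `PR_ℚ`-valued cofinite cocycle on `Γ₁(N)` that is parabolic with smooth semi-analytic values after a
     semi-analytic coboundary and is not itself a semi-analytic coboundary.  This is the instrument's search space.

All statements are over the landed named forms of the route's inlined `let`s
(`Theorems.HeckeRationalPeriods.IsQuarterCuspFormR / HasRationalPeriodClassR / heckeT`, part 1/4 of the 2807 proof);
`rationalPeriodClassesQuarter_iff` records that the route decl unfolds to the restated target (definitional).
-/

set_option linter.dupNamespace false

noncomputable section

namespace Summit.Langlands.Langlands.Theorems.SelfTwistPeriodLadder

open scoped MatrixGroups BigOperators
open Filter Set Literature.NumberTheory.Automorphic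
open Summit.Langlands.Langlands.Theorems.HeckeRationalPeriods

/-! ### The target, restated over the named helpers -/

/-- The crux `RationalPeriodClassesQuarter` over the named helpers of `…HeckePreservesRationalPeriodsDefs`. -/
def RationalPeriodClassesQuarterR : Prop :=
  ∀ N : ℕ, 0 < N → ∀ u : UpperHalfPlane → ℂ, IsQuarterCuspFormR N u →
    ∃ (m : ℕ) (v : Fin m → UpperHalfPlane → ℂ) (c : Fin m → ℂ),
      (∀ i, IsQuarterCuspFormR N (v i) ∧ HasRationalPeriodClassR N (v i)) ∧ ∀ z, u z = ∑ i, c i * v i z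

/-- The route decl unfolds to the restatement (definitional). -/
theorem rationalPeriodClassesQuarter_iff :
    Summit.Langlands.Langlands.Theses.RationalPeriodQuarter.RationalPeriodClassesQuarter ↔
      RationalPeriodClassesQuarterR := Iff.rfl

/-- `u` lies in the `ℂ`-span of the quarter cusp forms of level `N` with a rational period class
(the target's conclusion for a single form). -/
def InRationalSpanR (N : ℕ) (u : UpperHalfPlane → ℂ) : Prop :=
  ∃ (m : ℕ) (v : Fin m → UpperHalfPlane → ℂ) (c : Fin m → ℂ),
    (∀ i, IsQuarterCuspFormR N (v i) ∧ HasRationalPeriodClassR N (v i)) ∧ ∀ z, u z = ∑ i, c i * v i z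

/-! ### The grading: Hecke eigenforms and the self-twist (dihedral) type -/

/-- Simultaneous eigenform of the route's `Γ₁(N)` Hecke operators `T'_p = p^(-1/2) T_p^σ` (`p ∤ N`, `σ ∈ Γ₀(N)`,
`d_σ ≡ p (N)`; `heckeT`). -/
def IsHeckeEigenformR (N : ℕ) (u : UpperHalfPlane → ℂ) : Prop :=
  ∀ p : ℕ, p.Prime → ¬ p ∣ N → ∀ σ ∈ CongruenceSubgroup.Gamma0 N,
    (((σ : Matrix (Fin 2) (Fin 2) ℤ) 1 1 : ℤ) : ZMod N) = (p : ZMod N) →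
      ∃ a : ℂ, ∀ z : UpperHalfPlane, heckeT p σ u z = a * u z

/-- SELF-TWIST (dihedral / CM type): for some quadratic Dirichlet character `χ ≠ 1` of modulus `D ≥ 1`,
`T'_p u = 0` for every prime `p ∤ N` with `χ(p) = -1` (the inert primes).  For an eigenform this is `u ⊗ χ = u`. -/
def IsSelfTwistR (N : ℕ) (u : UpperHalfPlane → ℂ) : Prop :=
  ∃ D : ℕ, 0 < D ∧ ∃ χ : DirichletCharacter ℂ D, χ ≠ 1 ∧ χ ^ 2 = 1 ∧
    ∀ p : ℕ, p.Prime → ¬ p ∣ N → χ (p : ZMod D) = -1 → ∀ σ ∈ CongruenceSubgroup.Gamma0 N,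
      (((σ : Matrix (Fin 2) (Fin 2) ℤ) 1 1 : ℤ) : ZMod N) = (p : ZMod N) →
        ∀ z : UpperHalfPlane, heckeT p σ u z = 0

/-! ### The pieces -/

/-- piece P1 · EIGENFORM SPAN (support · KNOWN: finite-dimensionality of `S(N)` + simultaneous diagonalisation of
the normal commuting `T'_p`, `p ∤ N`; Iwaniec 2002 Thms 4.7/6.7 §8.5–8.6, Diamond–Shurman Thm 5.5.4). -/
def EigenformSpan : Prop :=
  ∀ N : ℕ, 0 < N → ∀ u : UpperHalfPlane → ℂ, IsQuarterCuspFormR N u →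
    ∃ (m : ℕ) (v : Fin m → UpperHalfPlane → ℂ) (c : Fin m → ℂ),
      (∀ i, IsQuarterCuspFormR N (v i) ∧ IsHeckeEigenformR N (v i)) ∧ ∀ z, u z = ∑ i, c i * v i z

/-- piece P2 · SELF-TWIST RUNG (crux · UNDECIDED; grade 0 of the type ladder): every self-twist quarter eigenform on
`Γ₁(N)` lies in the `ℂ`-span of the quarter cusp forms with a rational period class. -/
def SelfTwistRational : Prop :=
  ∀ N : ℕ, 0 < N → ∀ u : UpperHalfPlane → ℂ, IsQuarterCuspFormR N u → IsHeckeEigenformR N u →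
    IsSelfTwistR N u → InRationalSpanR N u

/-- piece P3 · NON-SELF-TWIST HEART (crux · residual · IDEA-NEEDED; grade ≥ 1): the same for quarter eigenforms
that are not self-twist. -/
def NonSelfTwistRational : Prop :=
  ∀ N : ℕ, 0 < N → ∀ u : UpperHalfPlane → ℂ, IsQuarterCuspFormR N u → IsHeckeEigenformR N u →
    ¬ IsSelfTwistR N u → InRationalSpanR N u

/-- rung E · RATIONAL CLASS EXISTS (aside · UNDECIDED · INSTRUMENTABLE): some nonzero quarter cusp form on some
`Γ₁(N)` has a rational period class.  Never decided in print; `¬ E` is the strong form of the route's kill item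
`NoRationalPeriodClass` (stmt-Langlands-2808). -/
def RationalClassExists : Prop :=
  ∃ N : ℕ, 0 < N ∧ ∃ u : UpperHalfPlane → ℂ,
    IsQuarterCuspFormR N u ∧ (∃ z, u z ≠ 0) ∧ HasRationalPeriodClassR N u

/-- support · KNOWN (Maass 1949; Bump, *Automorphic forms and representations* Thm 1.9.1 p. 110; automorphic
induction from a real quadratic field): a nonzero self-twist quarter eigenform exists on some `Γ₁(N)`. -/
def SelfTwistQuarterFormExists : Prop :=
  ∃ N : ℕ, 0 < N ∧ ∃ u : UpperHalfPlane → ℂ,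
    IsQuarterCuspFormR N u ∧ IsHeckeEigenformR N u ∧ IsSelfTwistR N u ∧ ∃ z, u z ≠ 0

/-! ### Span calculus -/

/-- The `ℂ`-span of the quarter cusp forms of level `N` with a rational period class. -/
def ratSpan (N : ℕ) : Submodule ℂ (UpperHalfPlane → ℂ) :=
  Submodule.span ℂ {v | IsQuarterCuspFormR N v ∧ HasRationalPeriodClassR N v}

/-- `InRationalSpanR N u` is membership in the `ℂ`-span `ratSpan N`. -/
theorem inRationalSpanR_iff_mem (N : ℕ) (u : UpperHalfPlane → ℂ) :
    InRationalSpanR N u ↔ u ∈ ratSpan N := by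
  constructor
  · rintro ⟨m, v, c, hv, hsum⟩
    have hu : u = ∑ i, c i • v i := by
      funext z
      simp [hsum z, Finset.sum_apply, Pi.smul_apply, smul_eq_mul]
    rw [hu]
    exact Submodule.sum_mem _ fun i _ => Submodule.smul_mem _ _ (Submodule.subset_span (hv i))
  · intro hu
    obtain ⟨m, c, v, hsum⟩ := (Submodule.mem_span_set'.1 hu)
    refine ⟨m, fun i => (v i : UpperHalfPlane → ℂ), c, fun i => (v i).2, fun z => ?_⟩
    have := congrArg (fun f : UpperHalfPlane → ℂ => f z) hsum
    simpa [Finset.sum_apply, Pi.smul_apply, smul_eq_mul] using this.symm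

/-- Finite combinations of forms in the rational span are in the rational span. -/
theorem inRationalSpanR_sum (N : ℕ) {m : ℕ} (v : Fin m → UpperHalfPlane → ℂ) (c : Fin m → ℂ)
    (hv : ∀ i, InRationalSpanR N (v i)) : InRationalSpanR N (fun z => ∑ i, c i * v i z) := by
  rw [inRationalSpanR_iff_mem]
  have : (fun z => ∑ i, c i * v i z) = ∑ i, c i • v i := by
    funext z
    simp [Finset.sum_apply, Pi.smul_apply, smul_eq_mul]
  rw [this]
  exact Submodule.sum_mem _ fun i _ => Submodule.smul_mem _ _ ((inRationalSpanR_iff_mem N _).1 (hv i))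

/-! ### GLUE: the pieces imply the target (restated and BY NAME) -/

/-- GLUE (restated target): eigenform span + both type-graded pieces give the rational span of all of `S(N)`. -/
theorem rationalPeriodClassesQuarterR_of_pieces (h₁ : EigenformSpan) (h₂ : SelfTwistRational)
    (h₃ : NonSelfTwistRational) : RationalPeriodClassesQuarterR := by
  intro N hN u hu
  obtain ⟨m, v, c, hv, hsum⟩ := h₁ N hN u hu
  have hvi : ∀ i, InRationalSpanR N (v i) := fun i => by
    by_cases h : IsSelfTwistR N (v i)
    · exact h₂ N hN _ (hv i).1 (hv i).2 h
    · exact h₃ N hN _ (hv i).1 (hv i).2 h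
  have hu' : u = fun z => ∑ i, c i * v i z := funext hsum
  rw [hu']
  exact inRationalSpanR_sum N v c hvi

/-- **GLUE**: `EigenformSpan → SelfTwistRational → NonSelfTwistRational → RationalPeriodClassesQuarter`
(the route decl BY NAME). -/
theorem rationalPeriodClassesQuarter_of_pieces (h₁ : EigenformSpan) (h₂ : SelfTwistRational)
    (h₃ : NonSelfTwistRational) :
    Summit.Langlands.Langlands.Theses.RationalPeriodQuarter.RationalPeriodClassesQuarter :=
  rationalPeriodClassesQuarter_iff.mpr (rationalPeriodClassesQuarterR_of_pieces h₁ h₂ h₃)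

/-! ### NECESSITY: P2 and P3 are literal restrictions of the target -/

/-- NECESSITY of P2: the target restricted to self-twist eigenforms. -/
theorem selfTwistRational_of_target (h : RationalPeriodClassesQuarterR) : SelfTwistRational :=
  fun N hN u hu _ _ => h N hN u hu

/-- NECESSITY of P3: the target restricted to non-self-twist eigenforms. -/
theorem nonSelfTwistRational_of_target (h : RationalPeriodClassesQuarterR) : NonSelfTwistRational :=
  fun N hN u hu _ _ => h N hN u hu

/-- NECESSITY of P2, from the route decl BY NAME. -/
theorem selfTwistRational_of_route
    (h : Summit.Langlands.Langlands.Theses.RationalPeriodQuarter.RationalPeriodClassesQuarter) :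
    SelfTwistRational ∧ NonSelfTwistRational :=
  ⟨selfTwistRational_of_target (rationalPeriodClassesQuarter_iff.mp h),
    nonSelfTwistRational_of_target (rationalPeriodClassesQuarter_iff.mp h)⟩

/-- EXACTNESS of the cut modulo the known piece: given eigenform span (P1), the target (route decl BY NAME) is
EQUIVALENT to the conjunction of the two graded pieces. -/
theorem target_iff_graded_of_eigenformSpan (h₁ : EigenformSpan) :
    Summit.Langlands.Langlands.Theses.RationalPeriodQuarter.RationalPeriodClassesQuarter ↔
      (SelfTwistRational ∧ NonSelfTwistRational) :=
  ⟨selfTwistRational_of_route, fun h => rationalPeriodClassesQuarter_of_pieces h₁ h.1 h.2⟩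

/-! ### THE RUNG: `P2 ⇒ E` given the known existence of theta forms, and `¬E` kills the target -/

/-- A nonzero form in the rational span forces a nonzero form WITH a rational period class. -/
theorem exists_nonzero_of_inRationalSpanR {N : ℕ} {u : UpperHalfPlane → ℂ} (hu : InRationalSpanR N u)
    {z₀ : UpperHalfPlane} (hz : u z₀ ≠ 0) :
    ∃ v : UpperHalfPlane → ℂ, IsQuarterCuspFormR N v ∧ (∃ z, v z ≠ 0) ∧ HasRationalPeriodClassR N v := by
  obtain ⟨m, v, c, hv, hsum⟩ := hu
  rw [hsum z₀] at hz
  obtain ⟨i, -, hi⟩ := Finset.exists_ne_zero_of_sum_ne_zero hz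
  exact ⟨v i, (hv i).1, ⟨z₀, fun h0 => hi (by simp [h0])⟩, (hv i).2⟩

/-- **RUNG**: the self-twist piece implies that a rational period class EXISTS (given Maass' theta forms). -/
theorem rationalClassExists_of_selfTwistRational (h₂ : SelfTwistRational)
    (hE : SelfTwistQuarterFormExists) : RationalClassExists := by
  obtain ⟨N, hN, u, hu, he, hs, z₀, hz⟩ := hE
  obtain ⟨v, hv, hvz, hq⟩ := exists_nonzero_of_inRationalSpanR (h₂ N hN u hu he hs) hz
  exact ⟨N, hN, v, hv, hvz, hq⟩

/-- The target implies the rung (given Maass' theta forms). -/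
theorem rationalClassExists_of_target (h : RationalPeriodClassesQuarterR)
    (hE : SelfTwistQuarterFormExists) : RationalClassExists :=
  rationalClassExists_of_selfTwistRational (selfTwistRational_of_target h) hE

/-- **KILL**: if NO nonzero quarter cusp form has a rational period class, the route's bet is false. -/
theorem not_target_of_noRationalClass (hE : SelfTwistQuarterFormExists) (hno : ¬ RationalClassExists) :
    ¬ Summit.Langlands.Langlands.Theses.RationalPeriodQuarter.RationalPeriodClassesQuarter :=
  fun h => hno (rationalClassExists_of_target (rationalPeriodClassesQuarter_iff.mp h) hE)

/-! ### The `u`-free form of the rung: Bruggeman–Lewis–Zagier Theorem B transport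

The rung `RationalClassExists` mentions a Maass form only through its period class.  By BLZ Theorem B (p. 6:
`Maass⁰_s(Γ) ≅ H¹_par(Γ; V_s^{ω*,∞})` for `0 < Re s < 1`, `s = 1/2` INCLUDED) "being the class of a `λ = 1/4` cusp
form" is a property of the cocycle alone: parabolic, with values in the SMOOTH semi-analytic vectors after a
semi-analytic coboundary.  Hence the rung has a `u`-FREE form `RationalCuspidalCocycleExists` — a statement about
piecewise-rational functions on `ℝ` and the group `Γ₁(N)` only — and the surjectivity half of Theorem B transports
it to `RationalClassExists` (`rationalClassExists_of_cuspidalCocycle`, proved here).  This is what makes the rung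
INSTRUMENTABLE (memo §3: a search over `PR_ℚ` cochains on generators of `Γ₁(N)` with local conditions at the cusps). -/

/-- The cofinite cocycle law on `Γ₁(N)` for the weight-`1/2` boundary action (route convention). -/
def IsCofiniteCocycleR (N : ℕ) (q : SL(2, ℤ) → ℝ → ℂ) : Prop :=
  ∀ γ ∈ CongruenceSubgroup.Gamma1 N, ∀ δ ∈ CongruenceSubgroup.Gamma1 N,
    ∀ᶠ t in cofinite, q (γ * δ) t = slashHalfR δ (q γ) t + q δ t

/-- rung E′ · RATIONAL CUSPIDAL COCYCLE EXISTS (aside · `u`-free · INSTRUMENTABLE): on some `Γ₁(N)` there is a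
`PR_ℚ`-valued cofinite cocycle `q` which, after a semi-analytic coboundary `df`, is PARABOLIC with values in the
smooth semi-analytic vectors `V_{1/2}^{ω*,∞}` (BLZ §9.3; tree: `IsSmoothSemiAnalyticVector`), and whose class is
nonzero (not a semi-analytic coboundary).  No Maass form occurs in this statement. -/
def RationalCuspidalCocycleExists : Prop :=
  ∃ N : ℕ, 0 < N ∧ ∃ (q : SL(2, ℤ) → ℝ → ℂ) (f : ℝ → ℂ),
    (∀ γ ∈ CongruenceSubgroup.Gamma1 N, IsPRQR (q γ)) ∧ IsCofiniteCocycleR N q ∧ IsSemiAnalyticR f ∧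
    (∀ γ ∈ CongruenceSubgroup.Gamma1 N, ∃ φ : ℝ → ℂ, IsSmoothSemiAnalyticVector (1 / 2 : ℂ) φ ∧
        ∀ᶠ t in cofinite, q γ t + slashHalfR γ f t - f t = φ t) ∧
    (∀ γ ∈ CongruenceSubgroup.Gamma1 N,
        (γ : Matrix (Fin 2) (Fin 2) ℤ).trace = 2 ∨ (γ : Matrix (Fin 2) (Fin 2) ℤ).trace = -2 →
        ∃ h : ℝ → ℂ, IsSmoothSemiAnalyticVector (1 / 2 : ℂ) h ∧
          ∀ᶠ t in cofinite, q γ t + slashHalfR γ f t - f t = slashHalfR γ h t - h t) ∧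
    ¬ ∃ g : ℝ → ℂ, IsSemiAnalyticR g ∧
        ∀ γ ∈ CongruenceSubgroup.Gamma1 N, ∀ᶠ t in cofinite, q γ t = slashHalfR γ g t - g t

/-- fact · BLZ THEOREM B at `s = 1/2` for `Γ₁(N)`, surjectivity half (Bruggeman–Lewis–Zagier, Mem. AMS 1118
(2015), Thm B p. 6 with (12.6), (14.8a) and the base-point change of §12.2; KNOWN IN PRINT — the tree's
`BLZPeriodCocycle*` files vendor Prop. 5.1 and §13.1 but explicitly not Theorems A–C): every parabolic cofinite
cocycle on `Γ₁(N)` with values in `V_{1/2}^{ω*,∞}` is, modulo a semi-analytic coboundary, the Lewis–Zagier cocycle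
of a quarter cusp form. -/
def BLZTheoremBSurjectiveQuarter : Prop :=
  ∀ N : ℕ, 0 < N → ∀ ψ : SL(2, ℤ) → ℝ → ℂ, IsCofiniteCocycleR N ψ →
    (∀ γ ∈ CongruenceSubgroup.Gamma1 N, ∃ φ : ℝ → ℂ, IsSmoothSemiAnalyticVector (1 / 2 : ℂ) φ ∧
        ∀ᶠ t in cofinite, ψ γ t = φ t) →
    (∀ γ ∈ CongruenceSubgroup.Gamma1 N,
        (γ : Matrix (Fin 2) (Fin 2) ℤ).trace = 2 ∨ (γ : Matrix (Fin 2) (Fin 2) ℤ).trace = -2 →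
        ∃ h : ℝ → ℂ, IsSmoothSemiAnalyticVector (1 / 2 : ℂ) h ∧
          ∀ᶠ t in cofinite, ψ γ t = slashHalfR γ h t - h t) →
    ∃ u : UpperHalfPlane → ℂ, IsQuarterCuspFormR N u ∧ ∃ h : ℝ → ℂ, IsSemiAnalyticR h ∧
      ∀ γ ∈ CongruenceSubgroup.Gamma1 N, ∀ᶠ t in cofinite,
        ψ γ t = lzCocycleR u γ t + slashHalfR γ h t - h t

/-- The right-action law of the route's slash off a finite set: `f|(γδ) ≡ (f|γ)|δ` (library
`lineSlash_mul_eventuallyEq` through the bridge `slashHalfR = lineSlash (1/2) ∘ mapGL`). -/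
theorem slashHalfR_mul_cofinite (γ δ : SL(2, ℤ)) (f : ℝ → ℂ) :
    ∀ᶠ t in cofinite, slashHalfR (γ * δ) f t = slashHalfR δ (slashHalfR γ f) t := by
  have h := lineSlash_mul_eventuallyEq (1 / 2 : ℂ) (Matrix.SpecialLinearGroup.mapGL ℝ γ)
    (Matrix.SpecialLinearGroup.mapGL ℝ δ) f
  rw [← map_mul] at h
  have e1 : slashHalfR γ f = lineSlash (1 / 2) (Matrix.SpecialLinearGroup.mapGL ℝ γ) f :=
    funext fun x => slashHalfR_eq_lineSlash γ f x
  refine h.mono fun t ht => ?_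
  rw [slashHalfR_eq_lineSlash, slashHalfR_eq_lineSlash, e1]
  exact ht

/-- The period cocycle of the zero function vanishes. -/
theorem lzCocycleR_of_zero (u : UpperHalfPlane → ℂ) (γ : SL(2, ℤ)) (t : ℝ) (hu : ∀ z, u z = 0) :
    lzCocycleR u γ t = 0 := by
  obtain rfl : u = 0 := funext hu
  rw [lzCocycleR_eq, lewisZagierCocycle_apply]
  simp [greenForm, wirtingerDz, Function.comp_def]

/-- **`u`-FREE RUNG ⇒ RUNG** (through the surjectivity half of BLZ Theorem B). -/
theorem rationalClassExists_of_cuspidalCocycle (hB : BLZTheoremBSurjectiveQuarter)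
    (hE : RationalCuspidalCocycleExists) : RationalClassExists := by
  obtain ⟨N, hN, q, f, hq, hcoc, hf, hsm, hpar, hnon⟩ := hE
  set ψ : SL(2, ℤ) → ℝ → ℂ := fun γ t => q γ t + slashHalfR γ f t - f t with hψ
  have hψcoc : IsCofiniteCocycleR N ψ := by
    intro γ hγ δ hδ
    filter_upwards [hcoc γ hγ δ hδ, slashHalfR_mul_cofinite γ δ f] with t h1 h2
    simp only [hψ, slashHalfR] at h1 h2 ⊢
    rw [h1, h2]
    ring
  obtain ⟨u, hu, h, hh, huψ⟩ :=
    hB N hN ψ hψcoc (fun γ hγ => hsm γ hγ) (fun γ hγ htr => hpar γ hγ htr)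
  have hfh : IsSemiAnalyticR (fun t => f t - h t) :=
    (isSemiAnalyticR_iff _).2 (((isSemiAnalyticR_iff _).1 hf).sub ((isSemiAnalyticR_iff _).1 hh))
  have hhf : IsSemiAnalyticR (fun t => h t - f t) :=
    (isSemiAnalyticR_iff _).2 (((isSemiAnalyticR_iff _).1 hh).sub ((isSemiAnalyticR_iff _).1 hf))
  have hclass : HasRationalPeriodClassR N u := by
    refine ⟨q, fun t => f t - h t, hq, hcoc, hfh, fun γ hγ => ?_⟩
    filter_upwards [huψ γ hγ] with t ht
    simp only [hψ, slashHalfR] at ht ⊢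
    linear_combination -ht
  refine ⟨N, hN, u, hu, ?_, hclass⟩
  by_contra hzero
  push Not at hzero
  refine hnon ⟨fun t => h t - f t, hhf, fun γ hγ => ?_⟩
  filter_upwards [huψ γ hγ] with t ht
  simp only [hψ, slashHalfR, lzCocycleR_of_zero u γ t hzero, zero_add] at ht ⊢
  linear_combination ht

end Summit.Langlands.Langlands.Theorems.SelfTwistPeriodLadder

-- kit: decomp-langlands-lens-1 g41, checked 2026-09-01 (no-snap record run)
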